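import Summits.FinalStateConjecture.FinalStateConjecture.Theorems.ClusterCompletenessRecurrentlyFlatDispersesStubAnchorCone
import Summits.FinalStateConjecture.FinalStateConjecture.Theorems.ClusterCompletenessRecurrentlyFlatDispersesStubChartFuture
import Summits.FinalStateConjecture.FinalStateConjecture.Theorems.ClusterCompletenessRecurrentlyFlatDispersesSlabCauchyExit
import Literature.Geometry.Lorentzian.NonImprisonmentProofs
import Literature.Geometry.Lorentzian.IdealPoints
import Literature.Geometry.Manifold.InverseFunctionTheorem

/-!
# Crux `RecurrentlyFlatDisperses` (stmt-FinalStateConjecture-14665), line `Sketch` — chart time runs to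
# `+∞` along every future-endless causal curve in the anchored chart region

Continuation lead c3, 2026-08-16. A geometric consequence of the crux's anchored-chart hypothesis, the
time dual of the landed `stub_slabCauchy` (past-endless causal curves through the chart above a slab
meet the slab): every FUTURE-ENDLESS future causal curve `γ` of the development which meets the late
image `W = Ψ₀{x⁰ > τ₀}` of the anchored chart reaches, later on, the chart region `Ψ₀{x⁰ > T}` above
EVERY chart time `T`. So the chart time `x⁰ ∘ Ψ₀⁻¹` is not only a time function on `W` but an
exhaustive one: a causal curve can leave `W`, or end, only with `x⁰ → +∞` — what the card
`outgoing-blind-cup-restart` (point (4)) and any restart/continuation argument on the late slabs use.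

Proof (`exists_mem_image_lateRegion_of_chart`). Suppose `γ` (future causal on an order-connected `s`,
future endless) passes `γ t ∈ W` and never enters `Ψ₀{x⁰ > T}` after `t`. Inside `W` the coordinate
lift `c = Ψ₀⁻¹ ∘ γ` has increasing chart time and drift `‖c u − c t‖ ≤ 2 (c⁰ u − c⁰ t)` (landed
causal cone estimate and lift, `SlabCauchy.lift_cone_causal`, `FutureSet.norm_sub_le_of_hasDerivAt`),
so as long as `γ` stays in `W` after `t` it stays in the image `Ψ₀(K)` of the COMPACT coordinate box
`K = {c⁰ t ≤ x⁰ ≤ T, ‖x − c t‖ ≤ 2 (T − c⁰ t)} ⊆ {x⁰ > τ₀}`. If `γ` leaves `W` after `t`, at the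
first exit parameter `σ` continuity gives `γ σ ∈ closure Ψ₀(K) = Ψ₀(K) ⊆ W`, a contradiction; if it
never leaves, the future-endless causal curve `γ|_{s ∩ [t, ∞)}` is imprisoned in the compact `Ψ₀(K)`,
against non-imprisonment in the strongly causal development
(`IsStronglyCausal.exists_forall_notMem_of_isCompact_holds`, O'Neill 1983, Ch. 14, Lemma 14.13). ∎

* `exists_mem_image_lateRegion_of_chart` — the geometric statement for an anchored chart in a
  strongly causal spacetime;
* `exists_mem_image_lateRegion` — the crux-vocabulary form (hypotheses = the crux's anchored
  conjuncts, verbatim), side conditions discharged by the landed `stub_anchorCone`, `stub_chartFuture`.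

Mathlib + the Literature cone + landed bricks of this line; no definitions, no named facts.
-/

noncomputable section

open scoped Manifold ContDiff Topology
open Bundle Filter Set Function TopologicalSpace Literature.Geometry.Lorentzian

namespace Summit.FinalStateConjecture.FinalStateConjecture.Theorems.RecurrentlyFlatDisperses

namespace ChartTime

/-- `2 ≤ ∞` in `ℕ∞ω` (the regularity threshold of the non-imprisonment fact). -/
private lemma two_le_infty : (2 : ℕ∞ω) ≤ ∞ := WithTop.coe_le_coe.mpr le_top

/-- The final segment `D ∩ [a, ∞)`, `a ∈ D`, of a future-endless curve is future endless (a future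
endpoint only depends on the future end of the parameter set; time dual of
`IsPastEndless.inter_Iic`). -/
theorem isFutureEndless_inter_Ici {M : Type*} [TopologicalSpace M] {Δ : ℝ → M} {D : Set ℝ}
    (h : IsFutureEndless Δ D) {a : ℝ} (ha : a ∈ D) : IsFutureEndless Δ (D ∩ Ici a) := by
  refine ⟨⟨a, ha, self_mem_Ici⟩, fun e he ↦ h.2 e ?_⟩
  rw [hasFutureEndpoint_iff (⟨a, ha, self_mem_Ici⟩ : (D ∩ Ici a).Nonempty)] at he
  rw [hasFutureEndpoint_iff ⟨a, ha⟩]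
  intro V hV
  obtain ⟨t, ht, htV⟩ := he V hV
  exact ⟨t, ht.1, fun t₁ ht₁ htt₁ ↦ htV t₁ ⟨ht₁, ht.2.trans htt₁⟩ htt₁⟩

/-- **Chart time is exhausted along future-endless causal curves (geometric form).** Let
`Ψ₀ : U₀ → 𝓢` be a smooth map on an open `U₀ ⊇ {x⁰ > τ₀}` of `E4` which is an open embedding on
the late region `{x⁰ > τ₀}`, anchored (`‖Ψ₀^* g − η‖ ≤ 1/4` pointwise on the late region) with
`dΨ₀ ∂₀` future-directed there, in a strongly causal spacetime. Then every future-endless future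
causal curve `γ` on an order-connected parameter set `s` with `γ t` in the late image reaches, at
some later parameter, the chart region above any chart time `T`. -/
theorem exists_mem_image_lateRegion_of_chart {𝓢 : Spacetime 4}
    (hsc : 𝓢.metric.IsStronglyCausal 𝓢.timeOrientation)
    {U₀ : Opens E4} {Ψ₀ : U₀ → 𝓢.carrier} {τ₀ : ℝ}
    (hΨs : ContMDiff 𝓘(ℝ, E4) (𝓡 4) ∞ Ψ₀)
    (hemb : Topology.IsOpenEmbedding (((Minkowski.backgroundOn U₀).lateRegion τ₀).restrict Ψ₀))
    (hU : {x : E4 | τ₀ < x 0} ⊆ (U₀ : Set E4))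
    (hdev : ∀ y : U₀, τ₀ < y.1 0 → ‖𝓢.deviation (Minkowski.backgroundOn U₀) Ψ₀ y‖ ≤ 1 / 4)
    (hfut : ∀ y : U₀, τ₀ < y.1 0 →
      𝓢.timeOrientation.IsFutureDirected (mfderiv 𝓘(ℝ, E4) (𝓡 4) Ψ₀ y (E4.basisVector 0)))
    {γ : ℝ → 𝓢.carrier} {s : Set ℝ} (hs : s.OrdConnected)
    (hγ : 𝓢.metric.IsFutureCausalCurveOn 𝓢.timeOrientation γ s) (hend : IsFutureEndless γ s)
    {t : ℝ} (ht : t ∈ s) (hγt : γ t ∈ Ψ₀ '' (Minkowski.backgroundOn U₀).lateRegion τ₀) (T : ℝ) :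
    ∃ t' ∈ s, t ≤ t' ∧ γ t' ∈ Ψ₀ '' (Minkowski.backgroundOn U₀).lateRegion T := by
  -- the late half-space `V` and the chart `Φ = Ψ₀|V` (as in the landed `stub_slabCauchy`)
  obtain ⟨V, hVmem⟩ : ∃ V : Opens E4, ∀ p : E4, p ∈ V ↔ τ₀ < p 0 :=
    ⟨⟨{x : E4 | τ₀ < x 0}, isOpen_lt continuous_const (PiLp.continuous_apply 2 _ 0)⟩,
      fun _ ↦ Iff.rfl⟩
  have hVU : V ≤ U₀ := fun p hp ↦ hU ((hVmem p).1 hp)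
  haveI : Nonempty V :=
    ⟨⟨(τ₀ + 1) • (E4.basisVector 0 : E4), (hVmem _).2 (by simp [E4.basisVector])⟩⟩
  have hlate : ∀ x : V, τ₀ < (Opens.inclusion hVU x).1 0 := fun x ↦ (hVmem x.1).1 x.2
  set Φ : V → 𝓢.carrier := Ψ₀ ∘ Opens.inclusion hVU with hΦdef
  have hΦs : ContMDiff 𝓘(ℝ, E4) (𝓡 4) ∞ Φ := hΨs.comp (contMDiff_inclusion hVU)
  have hdΦ : ∀ x : V, mfderiv 𝓘(ℝ, E4) (𝓡 4) Φ x =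
      mfderiv 𝓘(ℝ, E4) (𝓡 4) Ψ₀ (Opens.inclusion hVU x) := fun x ↦
    FutureSet.mfderiv_comp_inclusion hVU x (hΨs.mdifferentiableAt (by simp))
  have hrange : range Φ = Ψ₀ '' (Minkowski.backgroundOn U₀).lateRegion τ₀ :=
    FutureSet.range_comp_inclusion hVU Ψ₀ hVmem
  have hWopen : IsOpen (range Φ) := by
    rw [hrange, ← Set.range_restrict]
    exact hemb.isOpen_range
  have hinj : Injective Φ := by
    intro x₁ x₂ h
    have h' : (⟨Opens.inclusion hVU x₁, hlate x₁⟩ :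
        (Minkowski.backgroundOn U₀).lateRegion τ₀) = ⟨Opens.inclusion hVU x₂, hlate x₂⟩ :=
      hemb.injective h
    exact Subtype.ext (congrArg (fun y : (Minkowski.backgroundOn U₀).lateRegion τ₀ ↦
      (y.1 : E4)) h')
  have hloc : IsLocalDiffeomorph 𝓘(ℝ, E4) (𝓡 4) ∞ Φ := fun x ↦ by
    have hinjd : Injective (mfderiv 𝓘(ℝ, E4) (𝓡 4) Φ x) := by
      rw [hdΦ x]
      exact FutureSet.mfderiv_injective_of_deviation Ψ₀ _ (hdev _ (hlate x))
    set A : E4 →L[ℝ] E4 := mfderiv 𝓘(ℝ, E4) (𝓡 4) Φ x with hA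
    have hinjA : Injective (A : E4 →ₗ[ℝ] E4) := hinjd
    have hbij : Bijective (A : E4 →ₗ[ℝ] E4) :=
      ⟨hinjA, LinearMap.injective_iff_surjective.1 hinjA⟩
    set e : E4 ≃L[ℝ] E4 := (LinearEquiv.ofBijective (A : E4 →ₗ[ℝ] E4) hbij).toContinuousLinearEquiv
      with he
    exact Literature.Geometry.Manifold.isLocalDiffeomorphAt_of_mfderiv (by simp) isOpen_univ
      (mem_univ x) hΦs.contMDiffOn e (by ext v; rfl)
  have hcone : ∀ (x : V) (w : E4),
      𝓢.timeOrientation.IsFutureDirected (mfderiv 𝓘(ℝ, E4) (𝓡 4) Φ x w) →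
      0 < w 0 ∧ ‖w‖ < 2 * w 0 := by
    intro x w hf
    rw [hdΦ x] at hf
    exact SlabCauchy.cone_of_deviation_causal Ψ₀ (Opens.inclusion hVU x) (hdev _ (hlate x))
      (hfut _ (hlate x)) w hf
  -- the chart region above `T`, read through `Φ`
  have hTiff : ∀ x : V, T < (x : E4) 0 → Φ x ∈ Ψ₀ '' (Minkowski.backgroundOn U₀).lateRegion T :=
    fun x hx ↦ ⟨Opens.inclusion hVU x, hx, rfl⟩
  -- suppose `γ` never reaches the chart above `T` after `t`
  by_contra hcon
  push Not at hcon
  set W : Set 𝓢.carrier := range Φ with hWdef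
  have hγtW : γ t ∈ W := hrange ▸ hγt
  -- the coordinate lift and its bounds
  set c : ℝ → E4 := fun u ↦ ((Function.invFun Φ (γ u) : V) : E4) with hc
  have hΦc : ∀ u, γ u ∈ W → Φ (Function.invFun Φ (γ u)) = γ u := fun u hu ↦ Function.invFun_eq hu
  have hcT : ∀ u ∈ s, t ≤ u → γ u ∈ W → c u 0 ≤ T := fun u hu htu huW ↦ by
    by_contra h
    push Not at h
    exact hcon u hu htu ((hΦc u huW) ▸ hTiff _ h)
  have hct₀ : τ₀ < c t 0 := (hVmem _).1 (Function.invFun Φ (γ t)).2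
  -- the compact coordinate box and its image
  set K : Set E4 := {w : E4 | c t 0 ≤ w 0 ∧ w 0 ≤ T ∧ ‖w - c t‖ ≤ 2 * (T - c t 0)} with hKdef
  have hK1 : K = (fun w : E4 ↦ w 0) ⁻¹' Icc (c t 0) T ∩ Metric.closedBall (c t) (2 * (T - c t 0)) := by
    ext w
    simp only [hKdef, mem_setOf_eq, mem_inter_iff, mem_preimage, mem_Icc, Metric.mem_closedBall,
      dist_eq_norm, and_assoc]
  have hKclosed : IsClosed K := by
    rw [hK1]
    exact (isClosed_Icc.preimage (PiLp.continuous_apply 2 _ 0)).inter Metric.isClosed_closedBall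
  have hKcpt : IsCompact K :=
    (isCompact_closedBall (c t) _).of_isClosed_subset hKclosed (by rw [hK1]; exact inter_subset_right)
  have hKV : K ⊆ (V : Set E4) := fun w hw ↦ (hVmem w).2 (hct₀.trans_le hw.1)
  set K' : Set V := Subtype.val ⁻¹' K with hK'def
  have hK'img : Subtype.val '' K' = K := by
    ext w
    constructor
    · rintro ⟨y, hy, rfl⟩
      exact hy
    · intro hw
      exact ⟨⟨w, hKV hw⟩, hw, rfl⟩
  have hK'cpt : IsCompact K' :=
    Topology.IsEmbedding.subtypeVal.isCompact_iff.mpr (hK'img ▸ hKcpt)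
  set ΦK : Set 𝓢.carrier := Φ '' K' with hΦKdef
  have hΦKcpt : IsCompact ΦK := hK'cpt.image hΦs.continuous
  have hΦKW : ΦK ⊆ W := by
    rintro _ ⟨x, -, rfl⟩
    exact ⟨x, rfl⟩
  -- as long as `γ` stays in `W` after `t`, it stays in `Φ(K)`
  have hseg : ∀ u ∈ s, t ≤ u → (∀ v ∈ Icc t u, γ v ∈ W) → γ u ∈ ΦK := by
    intro u hu htu hin
    have hIs : Icc t u ⊆ s := fun v hv ↦ hs.out ht hu hv
    have hder : ∀ v ∈ Icc t u, HasDerivAt c (deriv c v) v ∧ 0 < deriv c v 0 ∧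
        ‖deriv c v‖ < 2 * deriv c v 0 := fun v hv ↦
      SlabCauchy.lift_cone_causal hΦs hinj hloc hcone (hγ v (hIs hv)).1 (hγ v (hIs hv)).2 (hin v hv)
    have hmono : StrictMonoOn (fun v ↦ c v 0) (Icc t u) :=
      FutureSet.strictMonoOn_apply_zero (w := fun v ↦ deriv c v) (convex_Icc t u)
        fun v hv ↦ ⟨(hder v hv).1, (hder v hv).2.1⟩
    have hdisp : ‖c u - c t‖ ≤ 2 * (c u 0 - c t 0) :=
      FutureSet.norm_sub_le_of_hasDerivAt (w := fun v ↦ deriv c v) htu fun v hv ↦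
        ⟨(hder v hv).1, (hder v hv).2.2.le⟩
    have h0 : c t 0 ≤ c u 0 := hmono.monotoneOn ⟨le_rfl, htu⟩ ⟨htu, le_rfl⟩ htu
    have h1 : c u 0 ≤ T := hcT u hu htu (hin u ⟨htu, le_rfl⟩)
    have hcuK : c u ∈ K := ⟨h0, h1, hdisp.trans (by linarith)⟩
    exact ⟨Function.invFun Φ (γ u), hcuK, hΦc u (hin u ⟨htu, le_rfl⟩)⟩
  by_cases hall : ∀ u ∈ s, t ≤ u → γ u ∈ W
  · -- CASE (b): `γ` never leaves `W` after `t` — imprisoned in the compact `Φ(K)`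
    set P : Set ℝ := s ∩ Ici t with hP
    have hPend : IsFutureEndless γ P := isFutureEndless_inter_Ici hend ht
    have hPoc : P.OrdConnected := hs.inter ordConnected_Ici
    have hγP : 𝓢.metric.IsFutureCausalCurveOn 𝓢.timeOrientation γ P := hγ.mono inter_subset_left
    obtain ⟨v₁, hv₁, hout⟩ :=
      LorentzianMetric.IsStronglyCausal.exists_forall_notMem_of_isCompact_holds two_le_infty hsc
        hΦKcpt hPoc hγP hPend
    exact hout v₁ hv₁ le_rfl (hseg v₁ hv₁.1 hv₁.2 fun v hv ↦ hall v (hs.out ht hv₁.1 hv) hv.1)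
  · -- CASE (a): the first parameter `σ ≥ t` at which `γ` is not in `W`
    push Not at hall
    obtain ⟨u₀, hu₀s, htu₀, hu₀W⟩ := hall
    set B : Set ℝ := {u | u ∈ s ∧ t ≤ u ∧ γ u ∉ W} with hB
    have hBne : B.Nonempty := ⟨u₀, hu₀s, htu₀, hu₀W⟩
    have hBbdd : BddBelow B := ⟨t, fun u hu ↦ hu.2.1⟩
    set σ : ℝ := sInf B with hσ
    have htσ : t ≤ σ := le_csInf hBne fun u hu ↦ hu.2.1
    have hσu₀ : σ ≤ u₀ := csInf_le hBbdd ⟨hu₀s, htu₀, hu₀W⟩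
    have hσs : σ ∈ s := hs.out ht hu₀s ⟨htσ, hσu₀⟩
    -- `γ σ ∉ W` (openness, continuity, `σ = inf B`)
    have hσW : γ σ ∉ W := by
      intro hσW
      have hn : γ ⁻¹' W ∈ 𝓝 σ := (hγ.continuousAt hσs).preimage_mem_nhds (hWopen.mem_nhds hσW)
      obtain ⟨δ, hδ, hball⟩ := Metric.mem_nhds_iff.1 hn
      obtain ⟨u, huB, hu⟩ := exists_lt_of_csInf_lt hBne (show σ < σ + δ by linarith)
      have hσu : σ ≤ u := csInf_le hBbdd huB
      have hub : u ∈ Metric.ball σ δ := by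
        rw [Metric.mem_ball, Real.dist_eq, abs_sub_lt_iff]
        constructor <;> linarith
      exact huB.2.2 (hball hub)
    have htσ' : t < σ := lt_of_le_of_ne htσ fun h ↦ hσW (h ▸ hγtW)
    -- before `σ`, `γ` is in `W`, hence in `Φ(K)`
    have hin : ∀ v ∈ Ico t σ, γ v ∈ W := fun v hv ↦ by
      by_contra h
      exact absurd (csInf_le hBbdd ⟨hs.out ht hσs ⟨hv.1, hv.2.le⟩, hv.1, h⟩) (not_le.2 hv.2)
    have hinK : ∀ u ∈ Ico t σ, γ u ∈ ΦK := fun u hu ↦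
      hseg u (hs.out ht hσs ⟨hu.1, hu.2.le⟩) hu.1 fun v hv ↦ hin v ⟨hv.1, lt_of_le_of_lt hv.2 hu.2⟩
    -- continuity at `σ` puts `γ σ` in the closed set `Φ(K) ⊆ W`
    have hlim : Tendsto γ (𝓝[<] σ) (𝓝 (γ σ)) :=
      (hγ.continuousAt hσs).tendsto.mono_left nhdsWithin_le_nhds
    have hev : ∀ᶠ u in 𝓝[<] σ, γ u ∈ ΦK := by
      filter_upwards [Ico_mem_nhdsLT htσ'] with u hu
      exact hinK u hu
    have hmem : γ σ ∈ ΦK := by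
      rw [← hΦKcpt.isClosed.closure_eq]
      exact mem_closure_of_tendsto hlim hev
    exact hσW (hΦKW hmem)

end ChartTime

/-! ### The crux-vocabulary form -/

/-- **Chart time runs to `+∞` along every future-endless causal curve through the crux's anchored
chart region.** In a maximal vacuum Cauchy development of admissible data, for an anchored flat late
chart of the crux's shape (hypotheses = the five anchored-chart conjuncts of
`Theses.ClusterCompleteness.RecurrentlyFlatDisperses`, verbatim), every future-endless future causal
curve `γ` (order-connected parameter set `s`) with `γ t ∈ Ψ₀ '' lateRegion τ₀` reaches, for every
chart time `T`, the region `Ψ₀ '' lateRegion T` at some parameter `t' ≥ t`; the side conditions of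
`ChartTime.exists_mem_image_lateRegion_of_chart` are the landed `stub_anchorCone`, `stub_chartFuture`
and the strong causality of the development (`CauchyDevelopment.isStronglyCausal`). -/
theorem exists_mem_image_lateRegion :
    ∀ (X : Type) [TopologicalSpace X] [ChartedSpace E3 X] [IsManifold (𝓡 3) ∞ X] [T2Space X]
      [SecondCountableTopology X] [ConnectedSpace X],
      ∀ D ∈ admissibleVacuumData X, ∀ 𝒟 : VacuumCauchyDevelopment D, 𝒟.IsMaximal →
        ∀ (O : Set 𝒟.carrier) (τ₀ : ℝ) (U₀ : Opens E4) (Ψ₀ : U₀ → 𝒟.carrier),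
          (𝒟.toSpacetime.IsLateChart (Minkowski.backgroundOn U₀) O τ₀ Ψ₀ ∧
            {x : E4 | τ₀ < x 0} ⊆ (U₀ : Set E4) ∧
            O = Summit.FinalStateConjecture.exteriorOf 𝒟.toCauchyDevelopment
              (Ψ₀ '' (Minkowski.backgroundOn U₀).lateRegion τ₀) ∧
            (∀ τ₁ : ℝ, τ₀ < τ₁ → O \ Ψ₀ '' (Minkowski.backgroundOn U₀).lateRegion τ₁ ⊆
              𝒟.metric.causalPast 𝒟.timeOrientation
                (Ψ₀ '' (Minkowski.backgroundOn U₀).timeSlab τ₁)) ∧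
            (∀ τ : ℝ, τ₀ < τ → 𝒟.toSpacetime.deviationCk (Minkowski.backgroundOn U₀) Ψ₀ 0 τ ≤
              ENNReal.ofReal (1 / 4))) →
          ∀ (γ : ℝ → 𝒟.carrier) (s : Set ℝ), s.OrdConnected →
            𝒟.metric.IsFutureCausalCurveOn 𝒟.timeOrientation γ s → IsFutureEndless γ s →
            ∀ t ∈ s, γ t ∈ Ψ₀ '' (Minkowski.backgroundOn U₀).lateRegion τ₀ →
              ∀ T : ℝ, ∃ t' ∈ s, t ≤ t' ∧ γ t' ∈ Ψ₀ '' (Minkowski.backgroundOn U₀).lateRegion T := by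
  intro X _ _ _ _ _ _ D hD 𝒟 hmax O τ₀ U₀ Ψ₀ hyp γ s hs hγ hend t ht hγt T
  have hA := stub_anchorCone
  have hT := stub_chartFuture hA
  have hdev : ∀ y : U₀, τ₀ < y.1 0 →
      ‖𝒟.toSpacetime.deviation (Minkowski.backgroundOn U₀) Ψ₀ y‖ ≤ 1 / 4 :=
    hA X D hD 𝒟 hmax O τ₀ U₀ Ψ₀ hyp
  have hfut : ∀ y : U₀, τ₀ < y.1 0 →
      𝒟.timeOrientation.IsFutureDirected (mfderiv 𝓘(ℝ, E4) (𝓡 4) Ψ₀ y (E4.basisVector 0)) :=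
    hT X D hD 𝒟 hmax O τ₀ U₀ Ψ₀ hyp
  obtain ⟨hchart, hU, -, -, -⟩ := hyp
  exact ChartTime.exists_mem_image_lateRegion_of_chart (𝓢 := 𝒟.toSpacetime)
    𝒟.toCauchyDevelopment.isStronglyCausal hchart.contMDiff hchart.isOpenEmbedding hU hdev hfut
    hs hγ hend ht hγt T

end Summit.FinalStateConjecture.FinalStateConjecture.Theorems.RecurrentlyFlatDisperses

end
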